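import Summits.CriticalPhenomena.PercolationContinuityZ3.Theorems.Transplant.FKConnectivityAllQForestNearTightPinnedEarsMain
import Summits.CriticalPhenomena.PercolationContinuityZ3.Theorems.Transplant.FKConnectivityAllQForestAdjacentFan
import HarnessLib

/-!
# THE FAN THEOREM and THE LOCALLY-CONNECTED THEOREM ON EVERY FIBRE (every finite multigraph)

Support file (`--supports stmt-CriticalPhenomena-4575`), FK sub-lane `prim-bschramm-fk-1` (gen 22) of the post-continuity programme;
builds on p205010 (kernel theorem, internal audit signed; external expert review pending).  No definitions, no named facts, no sorries;
standard axioms.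

`adjForestNoSq_fibre_of_fan` / `adjForestNoSq_fibre_of_linkReachable` (`…ForestAdjacentFan`) need all fan pairs FREE.  On a general fibre
`(M, u₀)` — a multigraph whose doubled pairs are the pinned pairs `u₀` — spokes and rims may be pinned.  THIS FILE removes the
restriction:
* **`adjForestNoSq_fibre_of_parallel`** — if a free pair `e' ≠ e` is PARALLEL to `e = ov` modulo `u₀` (`e' = o'v''` with `o ~ o'`,
  `v ~ v''` in `openGraph u₀`), then `bad ≤ good` (the single exchange `e ↔ e'`, then the class swap); `…_parallel_right` for `f`;
* **`adjForestNoSq_fibre_of_fan_pinned`** — THE FAN THEOREM ON EVERY FIBRE: distinct `x₀, …, x_ℓ ≠ o` (`ℓ ≥ 1`) with every spoke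
  `o x_i` and rim `x_{i−1} x_i` in `M ∪ u₀` ⇒ the node's inequality at `(o; x₀, x_ℓ)` on `(M, u₀)`.  Cases: ℓ = 1 (triangle theorem);
  `e` or `f` pinned (swap / inclusion); `e` or `f` absent — impossible here; an ear rim pinned (parallel copy of `e`/`f`, or `bad = 0`
  when the neighbouring spoke is pinned too); otherwise the pinned ears theorem `adjForestNoSq_fibre_of_ears_pinned` with the inner
  spokes/rims free or pinned;
* **`adjForestNoSq_fibre_of_linkReachable_pinned`** — THE LOCALLY-CONNECTED THEOREM ON EVERY FIBRE: `v ≠ y` joined by a path of pairs of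
  `M ∪ u₀` through vertices `w ≠ o` with `s(o, w) ∈ M ∪ u₀` ⇒ the node's inequality at `(o; v, y)`.  In words: for every finite
  multigraph (pair multiplicities ≤ 2), two pairs `ov, oy` at a vertex `o` whose far ends are joined inside the link of `o` are negatively
  correlated in the uniform ordered two-forest partition.
[cite: SempleWelsh2008, Conj. 1.1 (p. 2); Thm. 4.2 (p. 11)] [cite: Linusson2011, Prop. 2.6] [cite: Grimmett2006, §1.5 (p. 13)]
-/

noncomputable section

namespace Summit.CriticalPhenomena.PercolationContinuityZ3.Theorems
namespace FK

open Set Literature.Probability.LatticeModels Literature.Probability.Percolation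
open scoped Classical symmDiff

variable {V : Type*} [Fintype V]

/-! ### A parallel free copy of `e` -/

section Parallel

variable {M u₀ : BondConfig V} {o v y o' v'' : V}

/-- **A free pair parallel to `e` modulo the pinned pairs forces `bad ≤ good`**: if `e = ov, f = oy` (`v ≠ y`), `e' = o'v'' ∈ M` with
`e' ≠ e`, `o' ≠ v''`, and `o ~ o'`, `v ~ v''` in `openGraph u₀`, then `#(Fo ∩ {e,f ∈ ω}, Fo) ≤ #(Fo ∩ {e ∈ ω}, Fo ∩ {f ∈ ω})`
on `(M, u₀)`.  Proof: in a bad pair `e' ∉ ω` (else `o ~ v` off `e`); the exchange `e ↔ e'` is valid both ways (the `u₀`-paths carry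
the separation), lands in `{f, e' ∈ ω', e ∈ partner}`, and the class swap turns that into a good pair. [cite: Linusson2011, Prop. 2.6]
[cite: Grimmett2006, §1.5 (p. 13)] -/
theorem adjForestNoSq_fibre_of_parallel (hd : Disjoint u₀ M) (hov : o ≠ v) (hvy : v ≠ y) (ho'v'' : o' ≠ v'')
    (heM : s(o, v) ∈ M) (he'M : s(o', v'') ∈ M) (hne : s(o', v'') ≠ s(o, v))
    (hoo' : (openGraph u₀).Reachable o o') (hvv'' : (openGraph u₀).Reachable v v'') :
    fibreCount M u₀ (forestEv V ∩ {ω | s(o, v) ∈ ω ∧ s(o, y) ∈ ω}) (forestEv V) ≤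
      fibreCount M u₀ (forestEv V ∩ {ω | s(o, v) ∈ ω}) (forestEv V ∩ {ω | s(o, y) ∈ ω}) := by
  have hdis : ∀ {g : Sym2 V}, g ∈ M → g ∉ u₀ := fun hg hgu => Set.disjoint_left.1 hd hgu hg
  have hef : s(o, v) ≠ s(o, y) := fun h' => hvy (Sym2.congr_right.1 h')
  refine le_trans (fibreCount_exchange_le_of heM he'M (A' := forestEv V ∩ {ω | s(o, y) ∈ ω})
    (B' := forestEv V ∩ {ω | s(o, v) ∈ ω}) fun ω hω hA hB => ?_) (le_of_eq (fibreCount_swap _ _ _ _))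
  obtain ⟨hF, he, hf⟩ := hA
  have hF' : IsForestCfg (ω ∆ M) := hB
  have hu : u₀ ⊆ ω := subset_of_fibre hω
  have huB : u₀ ⊆ ω ∆ M := subset_symmDiff_of_fibre hω
  -- `e` closes no cycle: `o ↮ v` off `e`; `u₀ ⊆ ω ∖ {e}`
  have hue : u₀ ⊆ ω \ {s(o, v)} := fun z hz => ⟨hu hz, fun h => hdis heM (mem_singleton_iff.1 h ▸ hz)⟩
  have hsepe : ¬ (openGraph (ω \ {s(o, v)})).Reachable o v := by
    have hF2 : IsForestCfg (insert s(o, v) (ω \ {s(o, v)})) := by rwa [insert_sdiff_self_of_mem he]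
    exact ((isForestCfg_insert_iff hov fun h => h.2 rfl).1 hF2).2
  -- hence `e' ∉ ω`
  have he' : s(o', v'') ∉ ω := fun he'ω =>
    hsepe (((hoo'.mono (openGraph_mono hue)).trans (reach_of_mem_sdiff he'ω ho'v'' hne)).trans
      (hvv''.mono (openGraph_mono hue)).symm)
  have he'B : s(o', v'') ∈ ω ∆ M := (mem_symmDiff_iff_not_mem he'M).2 he'
  have hue' : u₀ ⊆ (ω ∆ M) \ {s(o', v'')} := fun z hz => ⟨huB hz, fun h => hdis he'M (mem_singleton_iff.1 h ▸ hz)⟩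
  have hsepe' : ¬ (openGraph ((ω ∆ M) \ {s(o', v'')})).Reachable o' v'' := by
    have hF2 : IsForestCfg (insert s(o', v'') ((ω ∆ M) \ {s(o', v'')})) := by rwa [insert_sdiff_self_of_mem he'B]
    exact ((isForestCfg_insert_iff ho'v'' fun h => h.2 rfl).1 hF2).2
  refine ⟨he, he', ⟨?_, mem_insert_of_mem _ ⟨hf, hef.symm⟩⟩, ?_, mem_insert _ _⟩
  · -- `ω − e + e'` is a forest: `o' ↮ v''` off `e` (else `o ~ o' ~ v'' ~ v` off `e`)
    refine (isForestCfg_insert_iff ho'v'' fun h => he' h.1).2 ⟨isForestCfg_of_subset hF sdiff_subset, fun hr => hsepe ?_⟩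
    exact ((hoo'.mono (openGraph_mono hue)).trans hr).trans (hvv''.mono (openGraph_mono hue)).symm
  · -- `(ω ∆ M) − e' + e` is a forest: `o ↮ v` off `e'` (else `o' ~ o ~ v ~ v''` off `e'`)
    have heB : s(o, v) ∉ (ω ∆ M) \ {s(o', v'')} := fun h => ((mem_symmDiff_iff_not_mem heM).1 h.1) he
    refine (isForestCfg_insert_iff hov heB).2 ⟨isForestCfg_of_subset hF' sdiff_subset, fun hr => hsepe' ?_⟩
    exact ((hoo'.mono (openGraph_mono hue')).symm.trans hr).trans (hvv''.mono (openGraph_mono hue'))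

/-- The same for a free pair parallel to `f` (swap the roles of `e` and `f`). [cite: Linusson2011, Prop. 2.6] -/
theorem adjForestNoSq_fibre_of_parallel_right (hd : Disjoint u₀ M) (hoy : o ≠ y) (hvy : v ≠ y) (ho'v'' : o' ≠ v'')
    (hfM : s(o, y) ∈ M) (he'M : s(o', v'') ∈ M) (hnf : s(o', v'') ≠ s(o, y))
    (hoo' : (openGraph u₀).Reachable o o') (hyv'' : (openGraph u₀).Reachable y v'') :
    fibreCount M u₀ (forestEv V ∩ {ω | s(o, v) ∈ ω ∧ s(o, y) ∈ ω}) (forestEv V) ≤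
      fibreCount M u₀ (forestEv V ∩ {ω | s(o, v) ∈ ω}) (forestEv V ∩ {ω | s(o, y) ∈ ω}) := by
  have h := adjForestNoSq_fibre_of_parallel (y := v) hd hoy hvy.symm ho'v'' hfM he'M hnf hoo' hyv''
  have hset : (forestEv V ∩ {ω : BondConfig V | s(o, y) ∈ ω ∧ s(o, v) ∈ ω}) = forestEv V ∩ {ω | s(o, v) ∈ ω ∧ s(o, y) ∈ ω} := by
    ext ω; simp only [mem_inter_iff, mem_setOf_eq]; tauto
  rw [hset] at h
  exact h.trans (le_of_eq (fibreCount_swap _ _ _ _))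

end Parallel

/-! ### Fans on every fibre -/

section FanPinned

variable {M u₀ : BondConfig V} {o : V}

/-- **THE FAN THEOREM ON EVERY FIBRE** (`ℓ ≥ 2`, ear pairs free): distinct `x 0, …, x ℓ ≠ o`, every spoke and rim in `M ∪ u₀`, and the
four ear pairs `o x₀, o x_ℓ, x₀ x₁, x_{ℓ−1} x_ℓ` free ⇒ the node's inequality at `(o; x 0, x ℓ)` on `(M, u₀)` — the pinned ears theorem
for the gadget `U = {o, x 0, …, x ℓ}`, `E` = spokes ∪ rims. [cite: SempleWelsh2008, Conj. 1.1 (p. 2)] [cite: Linusson2011, Prop. 2.6] -/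
theorem adjForestNoSq_fibre_of_fan_pinned_mem (hd : Disjoint u₀ M) {x : ℕ → V} {ℓ : ℕ} (hℓ : 2 ≤ ℓ)
    (hinj : ∀ i j, i ≤ ℓ → j ≤ ℓ → x i = x j → i = j) (hxo : ∀ i ≤ ℓ, x i ≠ o) (hsp : ∀ i ≤ ℓ, s(o, x i) ∈ M ∨ s(o, x i) ∈ u₀)
    (hrim : ∀ i < ℓ, s(x i, x (i + 1)) ∈ M ∨ s(x i, x (i + 1)) ∈ u₀) (heM : s(o, x 0) ∈ M) (hfM : s(o, x ℓ) ∈ M)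
    (hrM : s(x 0, x 1) ∈ M) (htM : s(x (ℓ - 1), x ℓ) ∈ M) :
    fibreCount M u₀ (forestEv V ∩ {ω | s(o, x 0) ∈ ω ∧ s(o, x ℓ) ∈ ω}) (forestEv V) ≤
      fibreCount M u₀ (forestEv V ∩ {ω | s(o, x 0) ∈ ω}) (forestEv V ∩ {ω | s(o, x ℓ) ∈ ω}) := by
  -- the gadget
  set U : Finset V := insert o ((Finset.range (ℓ + 1)).image x) with hU
  set E : Finset (Sym2 V) := (Finset.range (ℓ + 1)).image (fun i => s(o, x i)) ∪
    (Finset.range ℓ).image (fun i => s(x i, x (i + 1))) with hE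
  have hEMu : ∀ g ∈ E, g ∈ M ∨ g ∈ u₀ := by
    intro g hg
    rcases Finset.mem_union.1 hg with hg | hg
    · obtain ⟨i, hi, rfl⟩ := Finset.mem_image.1 hg
      exact hsp i (by have := Finset.mem_range.1 hi; omega)
    · obtain ⟨i, hi, rfl⟩ := Finset.mem_image.1 hg
      exact hrim i (Finset.mem_range.1 hi)
  have hoU : o ∈ U := Finset.mem_insert_self _ _
  have hxU : ∀ i ≤ ℓ, x i ∈ U := fun i hi =>
    Finset.mem_insert_of_mem (Finset.mem_image_of_mem x (Finset.mem_range.2 (by omega)))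
  have hEU : ∀ g ∈ E, ∀ w ∈ g, w ∈ U := by
    intro g hg w hw
    rcases Finset.mem_union.1 hg with hg | hg
    · obtain ⟨i, hi, rfl⟩ := Finset.mem_image.1 hg
      have hi' := Finset.mem_range.1 hi
      rcases Sym2.mem_iff.1 hw with rfl | rfl
      · exact hoU
      · exact hxU i (by omega)
    · obtain ⟨i, hi, rfl⟩ := Finset.mem_image.1 hg
      have hi' := Finset.mem_range.1 hi
      rcases Sym2.mem_iff.1 hw with rfl | rfl
      · exact hxU i (by omega)
      · exact hxU (i + 1) (by omega)
  -- counting: `|U| = ℓ + 2`, `|E| = 2ℓ + 1`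
  have hinj1 : Set.InjOn x ↑(Finset.range (ℓ + 1)) := fun i hi j hj h => by
    have hi' := Finset.mem_range.1 (Finset.mem_coe.1 hi)
    have hj' := Finset.mem_range.1 (Finset.mem_coe.1 hj)
    exact hinj i j (by omega) (by omega) h
  have hUcard : U.card = ℓ + 2 := by
    rw [hU, Finset.card_insert_of_notMem, Finset.card_image_of_injOn hinj1, Finset.card_range]
    intro ho
    obtain ⟨i, hi, hix⟩ := Finset.mem_image.1 ho
    exact hxo i (by have := Finset.mem_range.1 hi; omega) hix
  have hinj2 : Set.InjOn (fun i => s(o, x i)) ↑(Finset.range (ℓ + 1)) := fun i hi j hj h => by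
    have hi' := Finset.mem_range.1 (Finset.mem_coe.1 hi)
    have hj' := Finset.mem_range.1 (Finset.mem_coe.1 hj)
    exact hinj i j (by omega) (by omega) (Sym2.congr_right.1 h)
  have hinj3 : Set.InjOn (fun i => s(x i, x (i + 1))) ↑(Finset.range ℓ) := fun i hi j hj h => by
    have hi' := Finset.mem_range.1 (Finset.mem_coe.1 hi)
    have hj' := Finset.mem_range.1 (Finset.mem_coe.1 hj)
    rcases Sym2.eq_iff.1 h with ⟨h1, _⟩ | ⟨h1, h2⟩
    · exact hinj i j (by omega) (by omega) h1
    · have h3 := hinj i (j + 1) (by omega) (by omega) h1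
      have h4 := hinj (i + 1) j (by omega) (by omega) h2
      omega
  have hdisjE : Disjoint ((Finset.range (ℓ + 1)).image (fun i => s(o, x i)))
      ((Finset.range ℓ).image (fun i => s(x i, x (i + 1)))) := by
    rw [Finset.disjoint_left]
    intro g hg hg'
    obtain ⟨i, -, rfl⟩ := Finset.mem_image.1 hg
    obtain ⟨j, hj, hji⟩ := Finset.mem_image.1 hg'
    have hj' := Finset.mem_range.1 hj
    have ho : o ∈ s(x j, x (j + 1)) := by rw [hji]; exact Sym2.mem_mk_left _ _
    rcases Sym2.mem_iff.1 ho with h | h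
    · exact hxo j (by omega) h.symm
    · exact hxo (j + 1) (by omega) h.symm
  have hEcard : E.card = 2 * ℓ + 1 := by
    rw [hE, Finset.card_union_of_disjoint hdisjE, Finset.card_image_of_injOn hinj2, Finset.card_image_of_injOn hinj3,
      Finset.card_range, Finset.card_range]
    omega
  -- the pinned count: every fan pair is free or pinned, so `|E ∩ M| + 2|E ∩ u₀| ≥ |E| = 2ℓ + 1`
  have hdis : ∀ {g : Sym2 V}, g ∈ u₀ → g ∉ M := fun hg hgM => Set.disjoint_left.1 hd hg hgM
  have hfilt : (E.filter fun g => g ∈ u₀) = E.filter fun g => ¬ g ∈ M :=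
    Finset.filter_congr fun g hg => ⟨fun h => hdis h, fun h => (hEMu g hg).resolve_left h⟩
  have hsumc : (E.filter fun g => g ∈ M).card + (E.filter fun g => g ∈ u₀).card = E.card := by
    rw [hfilt]; exact Finset.card_filter_add_card_filter_not _
  have hcard : 2 * U.card ≤ (E.filter fun g => g ∈ M).card + 2 * (E.filter fun g => g ∈ u₀).card + 3 := by
    rw [hUcard]; omega
  -- memberships
  have hspE : ∀ i ≤ ℓ, s(o, x i) ∈ E := fun i hi =>
    Finset.mem_union_left _ (Finset.mem_image.2 ⟨i, Finset.mem_range.2 (by omega), rfl⟩)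
  have hrimE : ∀ i < ℓ, s(x i, x (i + 1)) ∈ E := fun i hi =>
    Finset.mem_union_right _ (Finset.mem_image.2 ⟨i, Finset.mem_range.2 hi, rfl⟩)
  have hrE : s(x 0, x 1) ∈ E := hrimE 0 (by omega)
  have htE : s(x (ℓ - 1), x ℓ) ∈ E := by
    have h := hrimE (ℓ - 1) (by omega)
    rwa [show ℓ - 1 + 1 = ℓ by omega] at h
  -- the ears
  have hve : ∀ g ∈ E, x 0 ∈ g → g = s(o, x 0) ∨ g = s(x 0, x 1) := by
    intro g hg h0
    rcases Finset.mem_union.1 hg with hg | hg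
    · obtain ⟨i, hi, rfl⟩ := Finset.mem_image.1 hg
      have hi' := Finset.mem_range.1 hi
      rcases Sym2.mem_iff.1 h0 with h | h
      · exact absurd h (hxo 0 (by omega))
      · have := hinj 0 i (by omega) (by omega) h
        subst this
        exact Or.inl rfl
    · obtain ⟨i, hi, rfl⟩ := Finset.mem_image.1 hg
      have hi' := Finset.mem_range.1 hi
      rcases Sym2.mem_iff.1 h0 with h | h
      · have := hinj 0 i (by omega) (by omega) h
        subst this
        exact Or.inr rfl
      · have := hinj 0 (i + 1) (by omega) (by omega) h
        omega
  have hye : ∀ g ∈ E, x ℓ ∈ g → g = s(o, x ℓ) ∨ g = s(x (ℓ - 1), x ℓ) := by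
    intro g hg h0
    rcases Finset.mem_union.1 hg with hg | hg
    · obtain ⟨i, hi, rfl⟩ := Finset.mem_image.1 hg
      have hi' := Finset.mem_range.1 hi
      rcases Sym2.mem_iff.1 h0 with h | h
      · exact absurd h (hxo ℓ le_rfl)
      · have := hinj ℓ i le_rfl (by omega) h
        subst this
        exact Or.inl rfl
    · obtain ⟨i, hi, rfl⟩ := Finset.mem_image.1 hg
      have hi' := Finset.mem_range.1 hi
      rcases Sym2.mem_iff.1 h0 with h | h
      · have := hinj ℓ i le_rfl (by omega) h
        omega
      · have := hinj ℓ (i + 1) le_rfl (by omega) h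
        refine Or.inr ?_
        rw [show ℓ - 1 = i by omega, ← this]
  -- distinctness
  have hov : o ≠ x 0 := (hxo 0 (by omega)).symm
  have hoy : o ≠ x ℓ := (hxo ℓ le_rfl).symm
  have hvy : x 0 ≠ x ℓ := fun h => by have := hinj 0 ℓ (by omega) le_rfl h; omega
  have hvv' : x 0 ≠ x 1 := fun h => by have := hinj 0 1 (by omega) (by omega) h; omega
  have hyy' : x ℓ ≠ x (ℓ - 1) := fun h => by have := hinj ℓ (ℓ - 1) le_rfl (by omega) h; omega
  have hv'y : x 1 ≠ x ℓ := fun h => by have := hinj 1 ℓ (by omega) le_rfl h; omega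
  have hvy' : x 0 ≠ x (ℓ - 1) := fun h => by have := hinj 0 (ℓ - 1) (by omega) (by omega) h; omega
  exact adjForestNoSq_fibre_of_ears_pinned hd hEMu hEU hcard (hspE 0 (by omega)) (hspE ℓ le_rfl) hrE htE hve hye hov hoy hvy hvv'
    hyy' hv'y hvy' heM hfM hrM htM

/-- **THE FAN THEOREM ON EVERY FIBRE, all `ℓ ≥ 1`**, no freeness assumptions: every spoke and rim in `M ∪ u₀`.
[cite: SempleWelsh2008, Conj. 1.1 (p. 2)] [cite: Linusson2011, Prop. 2.6] [cite: Grimmett2006, §1.5 (p. 13)] -/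
theorem adjForestNoSq_fibre_of_fan_pinned (hd : Disjoint u₀ M) {x : ℕ → V} {ℓ : ℕ} (hℓ : 1 ≤ ℓ)
    (hinj : ∀ i j, i ≤ ℓ → j ≤ ℓ → x i = x j → i = j) (hxo : ∀ i ≤ ℓ, x i ≠ o) (hsp : ∀ i ≤ ℓ, s(o, x i) ∈ M ∨ s(o, x i) ∈ u₀)
    (hrim : ∀ i < ℓ, s(x i, x (i + 1)) ∈ M ∨ s(x i, x (i + 1)) ∈ u₀) :
    fibreCount M u₀ (forestEv V ∩ {ω | s(o, x 0) ∈ ω ∧ s(o, x ℓ) ∈ ω}) (forestEv V) ≤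
      fibreCount M u₀ (forestEv V ∩ {ω | s(o, x 0) ∈ ω}) (forestEv V ∩ {ω | s(o, x ℓ) ∈ ω}) := by
  have hdis : ∀ {g : Sym2 V}, g ∈ u₀ → g ∉ M := fun hg hgM => Set.disjoint_left.1 hd hg hgM
  have hvy : x 0 ≠ x ℓ := fun h => by have := hinj 0 ℓ (by omega) le_rfl h; omega
  -- ℓ = 1: the triangle theorem (every membership pattern)
  rcases Nat.lt_or_ge ℓ 2 with h1 | h2
  · have hℓ1 : ℓ = 1 := by omega
    subst hℓ1
    exact adjForestNoSq_fibre_of_triangle hd hvy (hrim 0 (by omega))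
  have hov : o ≠ x 0 := (hxo 0 (by omega)).symm
  have hoy : o ≠ x ℓ := (hxo ℓ le_rfl).symm
  -- `e` pinned: the class swap maps bad pairs into good pairs
  rcases hsp 0 (by omega) with heM | heu
  swap
  · refine le_trans (fibreCount_mono_fibre M u₀ (A' := forestEv V ∩ {ω | s(o, x ℓ) ∈ ω}) (B' := forestEv V ∩ {ω | s(o, x 0) ∈ ω})
      fun ω hω hA hB => ?_) (le_of_eq (fibreCount_swap _ _ _ _))
    exact ⟨⟨hA.1, hA.2.2⟩, hB, Set.mem_symmDiff.2 (Or.inl ⟨subset_of_fibre hω heu, hdis heu⟩)⟩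
  -- `f` pinned: bad pairs are good pairs
  rcases hsp ℓ le_rfl with hfM | hfu
  swap
  · refine fibreCount_mono_fibre M u₀ fun ω hω hA hB => ?_
    exact ⟨⟨hA.1, hA.2.1⟩, hB, Set.mem_symmDiff.2 (Or.inl ⟨subset_of_fibre hω hfu, hdis hfu⟩)⟩
  -- the ear rim at `x 0` pinned: the spoke `o x₁` is a parallel copy of `e`, or `e` closes a cycle in every configuration
  have hx01 : x 0 ≠ x 1 := fun h => by have := hinj 0 1 (by omega) (by omega) h; omega
  have hxℓ' : x ℓ ≠ x (ℓ - 1) := fun h => by have := hinj ℓ (ℓ - 1) le_rfl (by omega) h; omega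
  rcases hrim 0 (by omega) with hrM | hru
  swap
  · rcases hsp 1 (by omega) with hh1M | hh1u
    · exact adjForestNoSq_fibre_of_parallel hd hov hvy (hxo 1 (by omega)).symm heM hh1M
        (fun h => hx01 (Sym2.congr_right.1 h).symm) SimpleGraph.Reachable.rfl (reach_of_mem hru hx01)
    · rw [fibreCount_eq_zero_of_forall _ _ _ _ fun ω hω hA _ =>
        not_isForestCfg_of_mem_of_reachable hA.2.1 (hdis.mt fun h => h heM |>.elim) (subset_of_fibre hω)
          ((reach_of_mem hh1u (hxo 1 (by omega)).symm).trans (reach_of_mem hru hx01).symm) hA.1]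
      exact Nat.zero_le _
  -- the ear rim at `x ℓ` pinned: symmetric
  have htE' : s(x (ℓ - 1), x ℓ) ∈ M ∨ s(x (ℓ - 1), x ℓ) ∈ u₀ := by
    have h := hrim (ℓ - 1) (by omega); rwa [show ℓ - 1 + 1 = ℓ by omega] at h
  rcases htE' with htM | htu
  swap
  · rcases hsp (ℓ - 1) (by omega) with hhM | hhu
    · exact adjForestNoSq_fibre_of_parallel_right hd hoy hvy (hxo (ℓ - 1) (by omega)).symm hfM hhM
        (fun h => hxℓ' (Sym2.congr_right.1 h).symm) SimpleGraph.Reachable.rfl (reach_of_mem htu hxℓ'.symm).symm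
    · rw [fibreCount_eq_zero_of_forall _ _ _ _ fun ω hω hA _ =>
        not_isForestCfg_of_mem_of_reachable hA.2.2 (hdis.mt fun h => h hfM |>.elim) (subset_of_fibre hω)
          ((reach_of_mem hhu (hxo (ℓ - 1) (by omega)).symm).trans (reach_of_mem htu hxℓ'.symm)) hA.1]
      exact Nat.zero_le _
  exact adjForestNoSq_fibre_of_fan_pinned_mem hd h2 hinj hxo hsp hrim heM hfM hrM htM

/-- **THE LOCALLY-CONNECTED THEOREM ON EVERY FIBRE**: if `v ≠ y` are joined by a path of pairs of `M ∪ u₀` all of whose vertices `w`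
satisfy `w ≠ o` and `s(o, w) ∈ M ∪ u₀` (i.e. `v ~ y` in the link of `o` of the multigraph of the fibre), then
`#(Fo ∩ {ov, oy ∈ ω}, Fo) ≤ #(Fo ∩ {ov ∈ ω}, Fo ∩ {oy ∈ ω})` on `(M, u₀)`. [cite: SempleWelsh2008, Conj. 1.1 (p. 2)]
[cite: Linusson2011, Prop. 2.6] [cite: Grimmett2006, §1.5 (p. 13)] -/
theorem adjForestNoSq_fibre_of_linkReachable_pinned (hd : Disjoint u₀ M) {v y : V} (hvy : v ≠ y)
    (h : (openGraph {g ∈ M ∪ u₀ | ∀ w ∈ g, w ≠ o ∧ s(o, w) ∈ M ∪ u₀}).Reachable v y) :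
    fibreCount M u₀ (forestEv V ∩ {ω | s(o, v) ∈ ω ∧ s(o, y) ∈ ω}) (forestEv V) ≤
      fibreCount M u₀ (forestEv V ∩ {ω | s(o, v) ∈ ω}) (forestEv V ∩ {ω | s(o, y) ∈ ω}) := by
  obtain ⟨p, hp⟩ := h.exists_isPath
  have hℓ : 1 ≤ p.length := by
    by_contra h0
    have h0' : p.length = 0 := by omega
    exact hvy (SimpleGraph.Walk.eq_of_length_eq_zero h0')
  have hedge : ∀ i < p.length, s(p.getVert i, p.getVert (i + 1)) ∈ M ∪ u₀ ∧
      (p.getVert i ≠ o ∧ s(o, p.getVert i) ∈ M ∪ u₀) ∧ (p.getVert (i + 1) ≠ o ∧ s(o, p.getVert (i + 1)) ∈ M ∪ u₀) := by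
    intro i hi
    have ha := p.adj_getVert_succ hi
    rw [openGraph_adj] at ha
    obtain ⟨⟨hgM, hgw⟩, -⟩ := ha
    exact ⟨hgM, hgw _ (Sym2.mem_mk_left _ _), hgw _ (Sym2.mem_mk_right _ _)⟩
  have hvert : ∀ i ≤ p.length, p.getVert i ≠ o ∧ s(o, p.getVert i) ∈ M ∪ u₀ := by
    intro i hi
    rcases Nat.lt_or_ge i p.length with hi' | hi'
    · exact (hedge i hi').2.1
    · have : i = p.length - 1 + 1 := by omega
      rw [this]
      exact (hedge (p.length - 1) (by omega)).2.2
  have key := adjForestNoSq_fibre_of_fan_pinned (M := M) (u₀ := u₀) (o := o) (x := p.getVert) hd hℓ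
    (fun i j hi hj hij => hp.getVert_injOn (by exact hi) (by exact hj) hij) (fun i hi => (hvert i hi).1)
    (fun i hi => (hvert i hi).2) (fun i hi => (hedge i hi).1)
  rwa [SimpleGraph.Walk.getVert_zero, SimpleGraph.Walk.getVert_length] at key

end FanPinned

end FK
end Summit.CriticalPhenomena.PercolationContinuityZ3.Theorems

end
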